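import Summits.ResolutionOfSingularities.ResolutionOfSingularities.Theorems.PurelyInseparableDim4Target
import Literature.AlgebraicGeometry.Resolution.PointBlowupDirectrixRank
import Literature.AlgebraicGeometry.Resolution.CentreBlowupMohStability
import Mathlib.Algebra.MvPolynomial.PDeriv
import HarnessLib
import HarnessLib.Audit.Tags

/-!
# Purely inseparable four-folds — the DIRECTRIX letter `ē` along point blow-ups (cell `res-dim4-pi`)

[OURS · counted 0 · a dictionary between the cell's frame `PIDim4.*` and the TREE's directrix
theory of `z^p + F(U)` (`Literature…PointBlowupNearRidge`, `…PointBlowupDirectrixRank`); nothing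
here is a new statement about resolution of singularities.]

The desk booked «p-12: q = 2 polar lemma» (WORD #26 (h)).  TREE FIRST: the polar lemma is in the
tree for every prime `p` and every number of variables — near points of the point blow-up of
`z^p + F` lie on the projectivised RIDGE of the tangent cone
(`CentreBlowup.nearOnDirectrixAtCentre`), the additive subspace `A(F_p)` of the initial form is
the kernel of the polar map `v ↦ Σ vᵢ ∂ᵢF_p` (`PointBlowup.mem_additiveSubspace_iff`; at `p = 2`
this is `A·v = 0` for the alternating matrix `a_{ik} = coeff_{eᵢ+e_k} F`),
`dim A(F_p) + dim ∇F_p = n`, and `ē = dim A` does not increase at near points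
([CJS 2020] Thm. 3.10 (4): `CentreBlowup.finrank_additiveSubspace_pointTransform_le`,
`CentreBlowup.ordZero_step_eq_of_isEquimultiplePoint`).  This file only READS those theorems in
the frame's vocabulary (`PIDim4.State`, `Edge`, `Step0`):

* §1 `additiveSubspace_deletePthPowers_homogeneousComponent` — cleaning (deleting `p`-th power
  monomials) does not change the additive subspace of the degree-`p` component (`∂ᵢ` kills
  `p`-th powers), so the letter `ē(s) := dim_K A(in(s.F))` is read on the frame's CLEANED states.
* §2 `additiveAlong_of_isEquimultiplePoint` / `direction_mem_additiveSubspace` — an `Edge p univ`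
  at `(j, b)` from a state of order `p` has its direction `e_j + Σ_{i≠j} bᵢeᵢ` in `A(F_p)`;
  hence **`no_step0_of_additiveSubspace_eq_bot`: `ē = 0` ⇒ the state is `Step0`-TERMINAL**
  (all `p`; at `p = 2`: polar matrix of rank 4 ⇒ no successor) and `ē ≥ 1` whenever a `Step0`
  successor exists.
* §3 `finrank_additiveSubspace_step_le` / `ordZero_step_eq` — along a `Step0` edge from a state
  with `ord₀ F = p` and `∇F_p ≠ 0`: the successor has order exactly `p`, `∇ ≠ 0` again, and
  `ē` does not increase.
* §4 `step0_chain_antitone` / `step0_chain_letter_bounds` — along every infinite `Step0` chain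
  from such a state: `ord = p` throughout, `ē` antitone, `1 ≤ ē ≤ 3` (`n = 4`), hence EVENTUALLY
  CONSTANT (`step0_chain_eventually_constant`): the census letter of the isolated regime (F4-I).
* (continued in `PurelyInseparableDim4DirectrixTwo.lean`: cleaned states have `∇ ≠ 0`; at
  `(p, q) = (2, 2)` with p-5's ISOLATED BAND, F4-I(2,2) ⟺ no isolated `Step0` chain along which
  `ē` is constant.)

Census note (desk WORD #20 frame v4, p-12 LOCATE 16:49Z): at `(p, n) = (2, 4)` the stable value
is `ē = 2`, the case that [CJS 2020] Thms 6.35/6.40 treat only under `char ≥ dim X/2 + 1 = 3`.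
Nothing here proves `NoIsolatedTrap p q` or resolution of singularities in dimension ≥ 4 /
characteristic `p`.  bears_on: LADDER-RESOLUTION:D157-DOOR2 (res-dim4-pi · polar lemma).
Supports stmt-ResolutionOfSingularities-16155 (helper).
-/

set_option linter.dupNamespace false

noncomputable section

namespace Summit.ResolutionOfSingularities.ResolutionOfSingularities.Theorems.PIDim4

namespace Directrix

open MvPolynomial Finset
open Literature.AlgebraicGeometry.Resolution
open Literature.AlgebraicGeometry.Resolution.Hauser2010
open Literature.AlgebraicGeometry.Resolution.HauserPerlega2019
open PointBlowup (direction AdditiveAlong gradSpan additiveSubspace polarMap)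

variable {K : Type} [Field K]

/-! ## 1. Cleaning does not change the additive subspace -/

/-- `∂ᵢ` kills the `p`-th power monomials: `∂ᵢ (delete p-th powers of P) = ∂ᵢ P` in characteristic
`p`. [folklore] -/
theorem pderiv_deletePthPowers (p : ℕ) [Fact p.Prime] [CharP K p] (i : Fin 4)
    (P : MvPolynomial (Fin 4) K) : pderiv i (deletePthPowers p P) = pderiv i P := by
  classical
  ext m
  rw [coeff_pderiv, coeff_pderiv, coeff_deletePthPowers]
  split_ifs with h
  · have hdvd : p ∣ m i + 1 := by
      have := h i (by
        rw [Finsupp.mem_support_iff, Finsupp.add_apply, Finsupp.single_eq_same]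
        omega)
      rwa [Finsupp.add_apply, Finsupp.single_eq_same] at this
    have hzero : ((m i : K) + 1) = 0 := by
      have := (CharP.cast_eq_zero_iff K p (m i + 1)).mpr hdvd
      push_cast at this
      exact this
    rw [hzero, mul_zero, mul_zero]
  · rfl

/-- Taking a homogeneous component commutes with deleting the `p`-th power monomials (both are
coefficientwise filters). [folklore] -/
theorem homogeneousComponent_deletePthPowers (p n : ℕ) (P : MvPolynomial (Fin 4) K) :
    homogeneousComponent n (deletePthPowers p P) = deletePthPowers p (homogeneousComponent n P) := by
  classical
  ext d
  rw [coeff_homogeneousComponent, coeff_deletePthPowers, coeff_deletePthPowers,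
    coeff_homogeneousComponent]
  split_ifs <;> rfl

/-- The polar map ignores `p`-th power monomials. [folklore] -/
theorem polarMap_deletePthPowers (p : ℕ) [Fact p.Prime] [CharP K p] (P : MvPolynomial (Fin 4) K) :
    polarMap (deletePthPowers p P) = polarMap P := by
  unfold polarMap
  congr 1
  funext i
  exact pderiv_deletePthPowers p i P

/-- **Cleaning does not change `A`**: the additive subspace of `delete p-th powers of P` is that of
`P`. [folklore] -/
theorem additiveSubspace_deletePthPowers (p : ℕ) [Fact p.Prime] [CharP K p]
    (P : MvPolynomial (Fin 4) K) :
    additiveSubspace (deletePthPowers p P) = additiveSubspace P := by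
  unfold additiveSubspace
  rw [polarMap_deletePthPowers]

/-- The degree-`p` component of a cleaned polynomial has the same additive subspace as that of the
polynomial before cleaning. [folklore] -/
theorem additiveSubspace_homogeneousComponent_deletePthPowers (p : ℕ) [Fact p.Prime] [CharP K p]
    (P : MvPolynomial (Fin 4) K) :
    additiveSubspace (homogeneousComponent p (deletePthPowers p P)) =
      additiveSubspace (homogeneousComponent p P) := by
  rw [homogeneousComponent_deletePthPowers, additiveSubspace_deletePthPowers]

/-- The initial form of a polynomial of order exactly `p` is its degree-`p` component and is a form of
degree `p`. [folklore] -/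
theorem initialForm_eq_homogeneousComponent {p : ℕ} {F : MvPolynomial (Fin 4) K}
    (hord : ordZero F = p) : initialForm F = homogeneousComponent p F := by
  rw [initialForm, hord, ENat.toNat_coe]

/-- The initial form at a point of order `p` is homogeneous of degree `p`. [folklore] -/
theorem initialForm_isHomogeneous {p : ℕ} {F : MvPolynomial (Fin 4) K} (hord : ordZero F = p) :
    (initialForm F).IsHomogeneous p := by
  rw [initialForm_eq_homogeneousComponent hord]
  exact homogeneousComponent_isHomogeneous p F

/-- A point of order exactly `p` is a `p`-fold point of the frame (`p ≤ ord_{C_univ} F = ord₀ F`).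
[folklore] -/
theorem le_ordAlong_univ_of_ordZero_eq {p : ℕ} {F : MvPolynomial (Fin 4) K} (hord : ordZero F = p) :
    (p : ℕ∞) ≤ CentreBlowup.ordAlong Finset.univ F := by
  rw [CentreBlowup.ordAlong_univ, hord]

/-! ## 2. Edges of the point blow-up: the direction lies in `A(F_p)`; `ē = 0` is terminal -/

section Edges

variable [DecidableEq K]

omit [DecidableEq K] in
/-- **Near ⇒ ridge, frame reading**: at a state of order `p`, an equimultiple point `b` (`b_j = 0`) of
the chart `x_j` of the POINT blow-up has its direction `e_j + Σ_{i ≠ j} bᵢ eᵢ` in the additive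
subspace: `F_p` is additive along it. [cite: CossartJannsenSaito2020, Thm. 3.14 (proof) and Rem. 18.29] -/
theorem additiveAlong_of_isEquimultiplePoint (p : ℕ) [Fact p.Prime] [CharP K p] {s : State K}
    (hord : ordZero s.F = p) {j : Fin 4} {b : Fin 4 → K} (hbj : b j = 0)
    (heq : CentreBlowup.IsEquimultiplePoint p Finset.univ j b s) :
    AdditiveAlong (initialForm s.F) (direction j b) :=
  CentreBlowup.nearOnDirectrixAtCentre p Finset.univ j (Finset.mem_univ j) b hbj
    (fun i hi => absurd (Finset.mem_univ i) hi) s hord (le_ordAlong_univ_of_ordZero_eq hord) heq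

omit [DecidableEq K] in
/-- The same as membership in `A(F_p) = ker (polar map)`. [cite: CossartJannsenSaito2020, Def. 2.18 and Thm. 3.14] -/
theorem direction_mem_additiveSubspace (p : ℕ) [Fact p.Prime] [CharP K p] {s : State K}
    (hord : ordZero s.F = p) {j : Fin 4} {b : Fin 4 → K} (hbj : b j = 0)
    (heq : CentreBlowup.IsEquimultiplePoint p Finset.univ j b s) :
    direction j b ∈ additiveSubspace (initialForm s.F) :=
  (PointBlowup.mem_additiveSubspace_iff p (initialForm_isHomogeneous hord) _).mpr
    (additiveAlong_of_isEquimultiplePoint p hord hbj heq)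

omit [DecidableEq K] in
/-- The direction of a chart point is never zero (its `j`-th coordinate is `1`). [folklore] -/
theorem direction_ne_zero (j : Fin 4) (b : Fin 4 → K) : direction j b ≠ 0 := by
  intro h
  have h1 : direction j b j = 0 := by rw [h]; rfl
  rw [direction, Function.update_self] at h1
  exact one_ne_zero h1

omit [DecidableEq K] in
/-- **`ē = 0` ⇒ no equimultiple point**: if the additive subspace of the initial form is trivial
(the tangent cone has trivial ridge/directrix; at `p = 2`: the polar matrix has rank `4`), no point
of the exceptional divisor of the point blow-up is `p`-fold again.
[cite: CossartJannsenSaito2020, Thm. 3.14 (near points lie on ℙ(Dir))] -/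
theorem not_isEquimultiplePoint_of_additiveSubspace_eq_bot (p : ℕ) [Fact p.Prime] [CharP K p]
    {s : State K} (hord : ordZero s.F = p) (hbot : additiveSubspace (initialForm s.F) = ⊥)
    {j : Fin 4} {b : Fin 4 → K} (hbj : b j = 0) :
    ¬ CentreBlowup.IsEquimultiplePoint p Finset.univ j b s := fun heq =>
  direction_ne_zero j b ((Submodule.mem_bot K).mp (hbot ▸ direction_mem_additiveSubspace p hord hbj heq))

/-- **`ē = 0` states are `Edge`-terminal for the point centre.** [OURS · frame reading]
[cite: CossartJannsenSaito2020, Thm. 3.14] -/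
theorem no_edge_univ_of_additiveSubspace_eq_bot (p : ℕ) [Fact p.Prime] [CharP K p] {s : State K}
    (hord : ordZero s.F = p) (hbot : additiveSubspace (initialForm s.F) = ⊥) :
    ¬ ∃ s', Edge p Finset.univ s s' := by
  rintro ⟨s', j, b, -, hbj, heq, -, -⟩
  exact not_isEquimultiplePoint_of_additiveSubspace_eq_bot p hord hbot hbj heq

/-- **`ē = 0` states are `Step0`-TERMINAL**: a state of order `p` whose initial form has trivial
additive subspace has no MODE-0 successor (all primes `p`; the `p = 2` instance is «polar matrix
of rank 4 ⇒ no successor»). [OURS · frame reading] [cite: CossartJannsenSaito2020, Thm. 3.14] -/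
theorem no_step0_of_additiveSubspace_eq_bot (p : ℕ) [Fact p.Prime] [CharP K p] {s : State K}
    (hord : ordZero s.F = p) (hbot : additiveSubspace (initialForm s.F) = ⊥) :
    ¬ ∃ s', Step0 p s s' := by
  rintro ⟨s', -, hedge⟩
  exact no_edge_univ_of_additiveSubspace_eq_bot p hord hbot ⟨s', hedge⟩

/-- Conversely a `Step0` successor forces `ē ≥ 1`. [OURS · frame reading]
[cite: CossartJannsenSaito2020, Thm. 3.14] -/
theorem one_le_finrank_additiveSubspace_of_step0 (p : ℕ) [Fact p.Prime] [CharP K p] {s s' : State K}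
    (hord : ordZero s.F = p) (h : Step0 p s s') :
    1 ≤ Module.finrank K (additiveSubspace (initialForm s.F)) := by
  by_contra hlt
  push Not at hlt
  have hbot : additiveSubspace (initialForm s.F) = ⊥ :=
    Submodule.finrank_eq_zero.mp (Nat.lt_one_iff.mp hlt)
  exact no_step0_of_additiveSubspace_eq_bot p hord hbot ⟨s', h⟩

end Edges

/-! ## 3. One `Step0` edge: order stays `p`, `∇ ≠ 0` persists, `ē` does not increase -/

section OneStep

variable [DecidableEq K]

omit [DecidableEq K] in
/-- `dim ∇Φ ≥ 1` iff `∇Φ ≠ ⊥`, phrased through `dim A(Φ) ≤ 3` (`dim A + dim ∇ = 4`). [folklore] -/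
theorem gradSpan_ne_bot_iff_finrank_additiveSubspace_le (Φ : MvPolynomial (Fin 4) K) :
    gradSpan Φ ≠ ⊥ ↔ Module.finrank K (additiveSubspace Φ) ≤ 3 := by
  have h := PointBlowup.finrank_additiveSubspace_add_finrank_gradSpan (K := K) Φ
  rw [Fintype.card_fin] at h
  rw [Ne, ← Submodule.finrank_eq_zero]
  omega

/-- **One `Step0` edge.** From a state of order `p` with `∇F_p ≠ 0` (e.g. a cleaned state of order
`p`), at an equimultiple point `b` (`b_j = 0`) of the point blow-up: the CLEANED successor
`s⁺ = CentreBlowup.step p univ j b s` has order exactly `p`, and `ē(s⁺) ≤ ē(s)`.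
[cite: CossartJannsenSaito2020, Thm. 3.10 (4)] -/
theorem ordZero_step_eq (p : ℕ) [Fact p.Prime] [CharP K p] {s : State K} (hord : ordZero s.F = p)
    (hgrad : gradSpan (initialForm s.F) ≠ ⊥) {j : Fin 4} {b : Fin 4 → K} (hbj : b j = 0)
    (heq : CentreBlowup.IsEquimultiplePoint p Finset.univ j b s) :
    ordZero (CentreBlowup.step p Finset.univ j b s).F = p :=
  CentreBlowup.ordZero_step_eq_of_isEquimultiplePoint p Finset.univ j (Finset.mem_univ j) b hbj
    (fun i hi => absurd (Finset.mem_univ i) hi) s hord (le_ordAlong_univ_of_ordZero_eq hord) hgrad heq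

/-- `ē` of the cleaned successor is `ē` of the degree-`p` component of the (uncleaned) point
transform. [folklore] -/
theorem additiveSubspace_initialForm_step (p : ℕ) [Fact p.Prime] [CharP K p] {s : State K}
    (hord : ordZero s.F = p) (hgrad : gradSpan (initialForm s.F) ≠ ⊥) {j : Fin 4} {b : Fin 4 → K}
    (hbj : b j = 0) (heq : CentreBlowup.IsEquimultiplePoint p Finset.univ j b s) :
    additiveSubspace (initialForm (CentreBlowup.step p Finset.univ j b s).F) =
      additiveSubspace (homogeneousComponent p (CentreBlowup.pointTransform p Finset.univ j b s)) := by
  rw [initialForm_eq_homogeneousComponent (ordZero_step_eq p hord hgrad hbj heq)]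
  exact additiveSubspace_homogeneousComponent_deletePthPowers p _

/-- **`ē(s⁺) ≤ ē(s)`** along a `Step0` edge ([CJS 2020] Thm. 3.10 (4) read on cleaned frame states).
[cite: CossartJannsenSaito2020, Thm. 3.10 (4)] -/
theorem finrank_additiveSubspace_step_le (p : ℕ) [Fact p.Prime] [CharP K p] {s : State K}
    (hord : ordZero s.F = p) (hgrad : gradSpan (initialForm s.F) ≠ ⊥) {j : Fin 4} {b : Fin 4 → K}
    (hbj : b j = 0) (heq : CentreBlowup.IsEquimultiplePoint p Finset.univ j b s) :
    Module.finrank K (additiveSubspace (initialForm (CentreBlowup.step p Finset.univ j b s).F)) ≤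
      Module.finrank K (additiveSubspace (initialForm s.F)) := by
  rw [additiveSubspace_initialForm_step p hord hgrad hbj heq]
  exact CentreBlowup.finrank_additiveSubspace_pointTransform_le p Finset.univ j (Finset.mem_univ j)
    b hbj (fun i hi => absurd (Finset.mem_univ i) hi) s hord (le_ordAlong_univ_of_ordZero_eq hord) heq

/-- `∇ ≠ 0` persists along the edge (since `ē` does not increase and `dim A + dim ∇ = 4`). [folklore] -/
theorem gradSpan_initialForm_step_ne_bot (p : ℕ) [Fact p.Prime] [CharP K p] {s : State K}
    (hord : ordZero s.F = p) (hgrad : gradSpan (initialForm s.F) ≠ ⊥) {j : Fin 4} {b : Fin 4 → K}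
    (hbj : b j = 0) (heq : CentreBlowup.IsEquimultiplePoint p Finset.univ j b s) :
    gradSpan (initialForm (CentreBlowup.step p Finset.univ j b s).F) ≠ ⊥ :=
  (gradSpan_ne_bot_iff_finrank_additiveSubspace_le _).mpr
    ((finrank_additiveSubspace_step_le p hord hgrad hbj heq).trans
      ((gradSpan_ne_bot_iff_finrank_additiveSubspace_le _).mp hgrad))

end OneStep

/-! ## 4. Along an infinite `Step0` chain: `ord = p`, `ē` antitone in `{1, 2, 3}`, eventually constant -/

section Chain

variable [DecidableEq K]

/-- Along a `Step0` chain from a state of order `p` with `∇F_p ≠ 0`, EVERY state has order exactly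
`p` and `∇ ≠ 0` (induction on §3). [cite: CossartJannsenSaito2020, Thm. 3.10 (4)] -/
theorem step0_chain_ordZero_eq (p : ℕ) [Fact p.Prime] [CharP K p] (c : ℕ → State K)
    (hc : ∀ k, Step0 p (c k) (c (k + 1))) (h0 : ordZero (c 0).F = p)
    (hg0 : gradSpan (initialForm (c 0).F) ≠ ⊥) (k : ℕ) :
    ordZero (c k).F = p ∧ gradSpan (initialForm (c k).F) ≠ ⊥ := by
  induction k with
  | zero => exact ⟨h0, hg0⟩
  | succ k ih =>
    obtain ⟨hord, hgrad⟩ := ih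
    obtain ⟨-, j, b, -, hbj, heq, -, hck⟩ := hc k
    rw [hck]
    exact ⟨ordZero_step_eq p hord hgrad hbj heq, gradSpan_initialForm_step_ne_bot p hord hgrad hbj heq⟩

/-- **The letter `ē` is antitone along every such `Step0` chain.** [cite: CossartJannsenSaito2020, Thm. 3.10 (4)] -/
theorem step0_chain_antitone (p : ℕ) [Fact p.Prime] [CharP K p] (c : ℕ → State K)
    (hc : ∀ k, Step0 p (c k) (c (k + 1))) (h0 : ordZero (c 0).F = p)
    (hg0 : gradSpan (initialForm (c 0).F) ≠ ⊥) :
    Antitone fun k => Module.finrank K (additiveSubspace (initialForm (c k).F)) := by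
  refine antitone_nat_of_succ_le fun k => ?_
  obtain ⟨hord, hgrad⟩ := step0_chain_ordZero_eq p c hc h0 hg0 k
  obtain ⟨-, j, b, -, hbj, heq, -, hck⟩ := hc k
  show Module.finrank K (additiveSubspace (initialForm (c (k + 1)).F)) ≤
    Module.finrank K (additiveSubspace (initialForm (c k).F))
  rw [hck]
  exact finrank_additiveSubspace_step_le p hord hgrad hbj heq

/-- **`1 ≤ ē ≤ 3` along every such chain** (`ē ≥ 1`: a successor exists; `ē ≤ 3`: `∇ ≠ 0`).
[cite: CossartJannsenSaito2020, Thm. 3.10 (4) and Thm. 3.14] -/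
theorem step0_chain_letter_bounds (p : ℕ) [Fact p.Prime] [CharP K p] (c : ℕ → State K)
    (hc : ∀ k, Step0 p (c k) (c (k + 1))) (h0 : ordZero (c 0).F = p)
    (hg0 : gradSpan (initialForm (c 0).F) ≠ ⊥) (k : ℕ) :
    1 ≤ Module.finrank K (additiveSubspace (initialForm (c k).F)) ∧
      Module.finrank K (additiveSubspace (initialForm (c k).F)) ≤ 3 := by
  obtain ⟨hord, hgrad⟩ := step0_chain_ordZero_eq p c hc h0 hg0 k
  exact ⟨one_le_finrank_additiveSubspace_of_step0 p hord (hc k),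
    (gradSpan_ne_bot_iff_finrank_additiveSubspace_le _).mp hgrad⟩

omit [DecidableEq K] in
/-- An antitone sequence of natural numbers is eventually constant. [folklore] -/
theorem exists_eventually_const_of_antitone (f : ℕ → ℕ) (hf : Antitone f) :
    ∃ N, ∀ k, N ≤ k → f k = f N := by
  obtain ⟨N, hN⟩ : ∃ N, f N = sInf (Set.range f) := Nat.sInf_mem (Set.range_nonempty f)
  refine ⟨N, fun k hk => le_antisymm (hf hk) ?_⟩
  rw [hN]
  exact Nat.sInf_le ⟨k, rfl⟩

/-- **The census letter of the isolated regime stabilises**: along every infinite `Step0` chain from a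
state of order `p` with `∇F_p ≠ 0`, `ē` is eventually constant with value in `{1, 2, 3}`
(`n = 4`).  At `p = 2` the stable value is `2` on cleaned chains (alternating polar form of rank `2`;
p-12 LOCATE note) — the case [CJS 2020] Thm. 6.40 treats only for `char ≥ dim X/2 + 1`.
[OURS · frame reading] [cite: CossartJannsenSaito2020, Thm. 3.10 (4) and Def. 3.13 (2)] -/
theorem step0_chain_eventually_constant (p : ℕ) [Fact p.Prime] [CharP K p] (c : ℕ → State K)
    (hc : ∀ k, Step0 p (c k) (c (k + 1))) (h0 : ordZero (c 0).F = p)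
    (hg0 : gradSpan (initialForm (c 0).F) ≠ ⊥) :
    ∃ N e, 1 ≤ e ∧ e ≤ 3 ∧
      ∀ k, N ≤ k → Module.finrank K (additiveSubspace (initialForm (c k).F)) = e := by
  obtain ⟨N, hN⟩ := exists_eventually_const_of_antitone _ (step0_chain_antitone p c hc h0 hg0)
  obtain ⟨h1, h3⟩ := step0_chain_letter_bounds p c hc h0 hg0 N
  exact ⟨N, _, h1, h3, hN⟩

/-- On the stable tail every edge is VERY NEAR in the sense of [CJS 2020] Def. 3.13 (2)
(`ē(s⁺) = ē(s)`), read on cleaned frame states. [OURS · frame reading]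
[cite: CossartJannsenSaito2020, Def. 3.13 (2)] -/
theorem step0_chain_eventually_veryNear (p : ℕ) [Fact p.Prime] [CharP K p] (c : ℕ → State K)
    (hc : ∀ k, Step0 p (c k) (c (k + 1))) (h0 : ordZero (c 0).F = p)
    (hg0 : gradSpan (initialForm (c 0).F) ≠ ⊥) :
    ∃ N, ∀ k, N ≤ k →
      Module.finrank K (additiveSubspace (initialForm (c (k + 1)).F)) =
        Module.finrank K (additiveSubspace (initialForm (c k).F)) := by
  obtain ⟨N, e, -, -, hN⟩ := step0_chain_eventually_constant p c hc h0 hg0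
  exact ⟨N, fun k hk => by rw [hN k hk, hN (k + 1) (Nat.le_succ_of_le hk)]⟩

end Chain

end Directrix

end Summit.ResolutionOfSingularities.ResolutionOfSingularities.Theorems.PIDim4

end
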